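import Summits.CriticalPhenomena.PercolationContinuityZ3.Theorems.Transplant.SkelPhiSeedSlabKit
import HarnessLib

/-!
# D″ node, φ-level generic layer ((B″), V98 p1 column): deep slab seeds avoid the Step-V pinning set
# `S = (shell from depth 2ℓs+2, all coordinates) ∪ (far faces)` — **`Skelφ.slabSeedDeep_notMem_wireSet`** — φ-level re-cut of `SkelSeedSlabDeepAvoid`
# (p237167), companion of `SkelPhiSeedSlab` / `SkelPhiSeedSlabKit`

builds on p205010 (kernel theorem, internal audit signed; external expert review pending) — nothing in this file uses p205010.
Lane `prim-bschramm`, seat `prim-bschramm-p1` (gen 9); helper file (`--supports stmt-CriticalPhenomena-4575 --as helper`).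
For a near contact every seed edge keeps an endpoint off `T`: the contact edge has `x ∉ T`; `y — p₀` has `y ∉ T` (`y` is near and on the
boundary layer); every other region edge has an endpoint among `p₁, …, p_K` or in the cylinder ball (interior, exit-depth `≤ 2ℓs+1`);
a rung `v — u` with `u` in the near face (`φ u` in the shell) has `v` in the cylinder ball (the path has exit-depth `≤ 1`, too far from
`u` by `Lip`).  For a far contact the seed is the contact edge.  Hypotheses `hlip : Skelφ.Lip G φ`, `hstep : Skelφ.Steps G φ`.
[cite: KozmaNitzan2024, §4 Lemma 10, p. 21 ("P_{K_ξ}(F_P) = P_G(F_P)", "Q ⊆ S"), pp. 21–22 (Step V)]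
-/

noncomputable section

open scoped Classical

namespace Summit.CriticalPhenomena.PercolationContinuityZ3.Theorems.Transplant

namespace Skelφ

open Literature.Probability.Percolation Literature.Probability.LatticeModels SimpleGraph KNLevels
open Literature.Probability.Percolation.KozmaNitzan.Cells (oth oth_ne eq_oth_of_ne oth_oth)
open Literature.Barriers.CriticalPhenomena (graphBall graphBall_finite mem_graphBall_self graphBall_mono)
open Skel (winGraph winGraph_adj KitGeom)
open SkelI (kitSeed mem_kitSeed_cases slabPt tanOff tanTgt tanSign deepPt)

variable {V : Type} [DecidableEq V] {G : SimpleGraph V} [G.LocallyFinite] {φ : V → Site 2}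

/-- **Deep slab seeds avoid the pairs of the Step-V pinning set**: if `T ⊆ B⟨j⟩` consists of SHELL vertices (`φ ∈ Icc (Lo + 2ℓs + 2)
(Hi − 2ℓs − 2)`, all coordinates) and FAR BOUNDARY-LAYER vertices (`φ ∉ Icc (Lo+1) (Hi−1)`, outside `B_G(w₀, R − r₀)`), and the near faces
lie in the shell, then no seed edge of the deep slab geometry is a pair of `T` (`ℓs ≥ 1`).
[cite: KozmaNitzan2024, §4 p. 21 ("P_{K_ξ}(F_P) = P_G(F_P)")] -/
theorem slabSeedDeep_notMem_wireSet (hlip : Lip G φ) (hstep : Steps G φ) {w₀ : V} {R : ℕ} {lo hi : Site 2} {j ℓs M R' r₀ : ℕ} {Unear : V → Finset V}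
    (hℓs : 1 ≤ ℓs) (hwide : ∀ i, (lo - (j : Site 2)) i + 2 * tanOff ℓs M ≤ (hi + (j : Site 2)) i)
    (hUsh : ∀ x ∈ outerBoundary (winGraph G w₀ R) (winLevel G φ w₀ R lo hi j), ∀ u ∈ Unear x,
      φ u ∈ Finset.Icc ((lo - (j : Site 2)) + ((2 * ℓs + 2 : ℕ) : Site 2)) ((hi + (j : Site 2)) - ((2 * ℓs + 2 : ℕ) : Site 2)))
    {x : V} (hx : x ∈ outerBoundary (winGraph G w₀ R) (winLevel G φ w₀ R lo hi j)) {T : Set V}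
    (hT : ∀ v ∈ T, φ v ∈ Finset.Icc (lo - (j : Site 2)) (hi + (j : Site 2)) ∧
      (φ v ∈ Finset.Icc ((lo - (j : Site 2)) + ((2 * ℓs + 2 : ℕ) : Site 2)) ((hi + (j : Site 2)) - ((2 * ℓs + 2 : ℕ) : Site 2)) ∨
        (φ v ∉ Finset.Icc ((lo - (j : Site 2)) + 1) ((hi + (j : Site 2)) - 1) ∧ v ∉ graphBall G w₀ (R - r₀))))
    {e : Sym2 V} (he : e ∈ kitSeed G (slabGeomDeep G φ w₀ R lo hi j ℓs M R' r₀ Unear) x) : e ∉ wireSet T := by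
  have hx' : x ∈ outerBoundary (winGraph G w₀ R) (Win G φ w₀ (Finset.Icc (lo - (j : Site 2)) (hi + (j : Site 2))) R) := hx
  have hw2 : ∀ i, (lo - (j : Site 2)) i + 2 ≤ (hi + (j : Site 2)) i := fun i => by have := hwide i; unfold tanOff at this; omega
  obtain ⟨hadj, hyR, hyP⟩ := inNbr_spec hx'
  -- scalar tests at the exit coordinate `i₀`
  have hTdef : tanOff ℓs M = 2 * ℓs + 2 + M := rfl
  -- (a) shell membership at coordinate `i`
  have hshell : ∀ v : V, φ v ∈ Finset.Icc ((lo - (j : Site 2)) + ((2 * ℓs + 2 : ℕ) : Site 2)) ((hi + (j : Site 2)) - ((2 * ℓs + 2 : ℕ) : Site 2)) →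
      ∀ i, (lo - (j : Site 2)) i + (2 * ℓs + 2) ≤ φ v i ∧ φ v i ≤ (hi + (j : Site 2)) i - (2 * ℓs + 2) := by
    intro v hv i
    rw [Finset.mem_Icc, Pi.le_def, Pi.le_def] at hv
    have h1 := hv.1 i; have h2 := hv.2 i
    simp only [Pi.add_apply, Pi.sub_apply, Pi.natCast_apply] at h1 h2
    push_cast at h1 h2
    constructor
    · have : (lo - (j : Site 2)) i = lo i - j := by simp
      linarith
    · have : (hi + (j : Site 2)) i = hi i + j := by simp
      linarith
  -- (b) interior membership from scalar bounds
  have hinter : ∀ v : V, (∀ i, (lo - (j : Site 2)) i + 1 ≤ φ v i ∧ φ v i ≤ (hi + (j : Site 2)) i - 1) → φ v ∈ Finset.Icc ((lo - (j : Site 2)) + 1) ((hi + (j : Site 2)) - 1) := by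
    intro v h
    rw [Finset.mem_Icc, Pi.le_def, Pi.le_def]
    exact ⟨fun i => by have := (h i).1; simp only [Pi.add_apply, Pi.one_apply]; linarith,
      fun i => by have := (h i).2; simp only [Pi.sub_apply, Pi.one_apply]; linarith⟩
  -- WHO IS OUTSIDE `T`
  have hxT : x ∉ T := fun hxT => ((mem_outerBoundary_win_iff G φ).1 hx').2.1 (hT x hxT).1
  -- the exit coordinate of `y` is on the face
  have hyface : φ (inNbr G φ w₀ R (Finset.Icc (lo - (j : Site 2)) (hi + (j : Site 2))) x) (exitDir G φ w₀ R (lo - (j : Site 2)) (hi + (j : Site 2)) x).1 = (hi + (j : Site 2)) (exitDir G φ w₀ R (lo - (j : Site 2)) (hi + (j : Site 2)) x).1 ∨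
      φ (inNbr G φ w₀ R (Finset.Icc (lo - (j : Site 2)) (hi + (j : Site 2))) x) (exitDir G φ w₀ R (lo - (j : Site 2)) (hi + (j : Site 2)) x).1 = (lo - (j : Site 2)) (exitDir G φ w₀ R (lo - (j : Site 2)) (hi + (j : Site 2)) x).1 := by
    rcases exitDir_spec hlip hx' with ⟨-, h⟩ | ⟨-, h⟩
    · exact Or.inl h
    · exact Or.inr h
  have hyT : inNbr G φ w₀ R (Finset.Icc (lo - (j : Site 2)) (hi + (j : Site 2))) x ∈ graphBall G w₀ (R - r₀) → inNbr G φ w₀ R (Finset.Icc (lo - (j : Site 2)) (hi + (j : Site 2))) x ∉ T := fun hnear h => by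
    rcases (hT _ h).2 with h' | ⟨-, h'⟩
    · have hs := hshell _ h' (exitDir G φ w₀ R (lo - (j : Site 2)) (hi + (j : Site 2)) x).1
      have := hw2 (exitDir G φ w₀ R (lo - (j : Site 2)) (hi + (j : Site 2)) x).1
      rcases hyface with hf | hf <;> rw [hf] at hs <;> omega
    · exact h' hnear
  -- cylinder-ball vertices are interior and below the shell in the exit coordinate
  have hcylT : ∀ v ∈ cylBall G φ (deepCtr G φ w₀ R (lo - (j : Site 2)) (hi + (j : Site 2)) ℓs M x) ℓs R', v ∉ T := by
    intro v hv hvT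
    obtain ⟨hin, hdep, -⟩ := φ_cyl_deepCtr hlip hstep hwide hx' (cylBall_subset_cyl G φ _ ℓs R' hv)
    rcases (hT v hvT).2 with h' | ⟨h', -⟩
    · have hs := hshell v h' (exitDir G φ w₀ R (lo - (j : Site 2)) (hi + (j : Site 2)) x).1
      have := hw2 (exitDir G φ w₀ R (lo - (j : Site 2)) (hi + (j : Site 2)) x).1
      rcases hdep with hd | hd <;> omega
    · exact h' (hinter v hin)
  -- path vertices from the first tangential step on are interior with exit-depth 1
  have hpT : ∀ k, 1 ≤ k → k ≤ pathLen φ (lo - (j : Site 2)) (hi + (j : Site 2)) ℓs M (exitDir G φ w₀ R (lo - (j : Site 2)) (hi + (j : Site 2)) x).1 (inNbr G φ w₀ R (Finset.Icc (lo - (j : Site 2)) (hi + (j : Site 2))) x) →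
      pathPt G φ (lo - (j : Site 2)) (hi + (j : Site 2)) ℓs M (exitDir G φ w₀ R (lo - (j : Site 2)) (hi + (j : Site 2)) x).1 (inNbr G φ w₀ R (Finset.Icc (lo - (j : Site 2)) (hi + (j : Site 2))) x) k ∉ T := by
    intro k hk1 hk hvT
    have hex := φ_pathPt_exit hlip hstep (ℓs := ℓs) (M := M) hw2 hx' k
    have htan := (φ_pathPt_tan hstep (exitDir G φ w₀ R (lo - (j : Site 2)) (hi + (j : Site 2)) x).1 (hw2 _) (hwide _) hyP hk).2.2 hk1
    have hw0 := hw2 (exitDir G φ w₀ R (lo - (j : Site 2)) (hi + (j : Site 2)) x).1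
    rcases (hT _ hvT).2 with h' | ⟨h', -⟩
    · have hs := hshell _ h' (exitDir G φ w₀ R (lo - (j : Site 2)) (hi + (j : Site 2)) x).1
      rw [hex] at hs
      rcases exitDir_spec hlip hx' with ⟨hsg, hc⟩ | ⟨hsg, hc⟩ <;> rw [hsg, hc] at hs <;> push_cast at hs <;> omega
    · refine h' (hinter _ fun i => ?_)
      by_cases hi : i = (exitDir G φ w₀ R (lo - (j : Site 2)) (hi + (j : Site 2)) x).1
      · rw [hi, hex]
        rcases exitDir_spec hlip hx' with ⟨hsg, hc⟩ | ⟨hsg, hc⟩ <;> rw [hsg, hc] <;> push_cast <;> constructor <;> omega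
      · rw [eq_oth_of_ne hi]; exact htan
  intro hw
  rcases mem_kitSeed_cases _ he with rfl | hE | ⟨v, hv, u, hu, hvu, rfl⟩
  · exact hxT (hw.1 x (Sym2.mem_mk_left _ _))
  · -- an edge inside the region
    simp only [slabGeomDeep] at hE
    split_ifs at hE with hnear
    · rw [mem_edgesIn_iff] at hE
      induction e using Sym2.ind with
      | h a b =>
        have ha := hE.2 a (Sym2.mem_mk_left a b); have hb := hE.2 b (Sym2.mem_mk_right a b)
        have haT := hw.1 a (Sym2.mem_mk_left a b); have hbT := hw.1 b (Sym2.mem_mk_right a b)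
        have hab : G.Adj a b := (SimpleGraph.mem_edgeSet (G := G)).1 hE.1
        -- every region vertex in `T` is `p₀`
        have hmemT : ∀ c ∈ (insert (inNbr G φ w₀ R (Finset.Icc (lo - (j : Site 2)) (hi + (j : Site 2))) x) (pathFin G φ (lo - (j : Site 2)) (hi + (j : Site 2)) ℓs M (exitDir G φ w₀ R (lo - (j : Site 2)) (hi + (j : Site 2)) x).1 (inNbr G φ w₀ R (Finset.Icc (lo - (j : Site 2)) (hi + (j : Site 2))) x)) ∪
            cylBallFin G φ (deepCtr G φ w₀ R (lo - (j : Site 2)) (hi + (j : Site 2)) ℓs M x) ℓs R' : Finset V), c ∈ T →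
            c = pathPt G φ (lo - (j : Site 2)) (hi + (j : Site 2)) ℓs M (exitDir G φ w₀ R (lo - (j : Site 2)) (hi + (j : Site 2)) x).1 (inNbr G φ w₀ R (Finset.Icc (lo - (j : Site 2)) (hi + (j : Site 2))) x) 0 := by
          intro c hc hcT
          rw [Finset.mem_union, Finset.mem_insert] at hc
          rcases hc with (rfl | hc) | hc
          · exact absurd hcT (hyT hnear)
          · unfold pathFin at hc
            rw [Finset.mem_image] at hc
            obtain ⟨k, hk, rfl⟩ := hc
            rw [Finset.mem_range] at hk
            by_cases hk0 : k = 0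
            · rw [hk0]
            · exact absurd hcT (hpT k (by omega) (by omega))
          · exact absurd hcT (hcylT c ((mem_cylBallFin G φ).1 hc))
        exact hab.ne ((hmemT a ha haT).trans (hmemT b hb hbT).symm)
    · -- far: the region is `{y}`, no edge inside
      rw [mem_edgesIn_iff] at hE
      induction e using Sym2.ind with
      | h a b =>
        have ha := hE.2 a (Sym2.mem_mk_left a b); have hb := hE.2 b (Sym2.mem_mk_right a b)
        rw [Finset.mem_singleton] at ha hb
        exact ((SimpleGraph.mem_edgeSet (G := G)).1 hE.1).ne (ha.trans hb.symm)
  · -- a rung `v — u`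
    simp only [slabGeomDeep] at hv hu
    split_ifs at hv hu with hnear
    · have huS := hshell u (hUsh x hx u hu) (exitDir G φ w₀ R (lo - (j : Site 2)) (hi + (j : Site 2)) x).1
      have hvT : v ∈ T := hw.1 v (Sym2.mem_mk_left _ _)
      rw [Finset.mem_union, Finset.mem_insert] at hv
      have hl := hlip hvu (exitDir G φ w₀ R (lo - (j : Site 2)) (hi + (j : Site 2)) x).1
      rw [abs_le] at hl
      have hw0 := hw2 (exitDir G φ w₀ R (lo - (j : Site 2)) (hi + (j : Site 2)) x).1
      rcases hv with (rfl | hv) | hv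
      · -- `v = y`: exit-depth 0, `u` at exit-depth ≥ 2ℓs+2
        rcases hyface with hf | hf <;> rw [hf] at hl <;> omega
      · -- `v = p_k`: exit-depth 1
        unfold pathFin at hv
        rw [Finset.mem_image] at hv
        obtain ⟨k, -, rfl⟩ := hv
        have hex := φ_pathPt_exit hlip hstep (ℓs := ℓs) (M := M) hw2 hx' k
        rw [hex] at hl
        rcases exitDir_spec hlip hx' with ⟨hsg, hc⟩ | ⟨hsg, hc⟩ <;> rw [hsg, hc] at hl <;> push_cast at hl <;> omega
      · exact hcylT v ((mem_cylBallFin G φ).1 hv) hvT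
    · rw [Finset.mem_singleton] at hv hu
      exact hvu.ne (hv.trans hu.symm)

end Skelφ

end Summit.CriticalPhenomena.PercolationContinuityZ3.Theorems.Transplant

end
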